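import Summits.QuantumAdvantage.QuantumAdvantage.Theorems.WbwObfuscatedGluedTreesKowRiVocabulary

/-!
# Stub `stub_locality` — the bit oracle reads the cycle datum only through atoms, and atoms are cylinders
# (crux `WbwObfuscatedGluedTrees`, stmt-QuantumAdvantage-2340; line `knowledge-of-walk-split`, stage 6, real→ideal layer)

The black-box walker of stages 5/6 talks to an instance `(σ, ν)` (cycle datum `σ = (e, f)`, injective naming `ν`)
only through the BIT ORACLE `bitOracle σ ν` (stage-5 vocabulary): a query `q` of length `N + N` names a vertex by
its first `N` bits (if any) and asks one bit of the coded, sorted neighbour list of that vertex in `graph d σ`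
transported by `ν`.  This file proves the LOCALITY statement consumed verbatim by the lead's coefficient-H stub
`stub_hcoeffCycle`:

* (i) the answer to `q` depends on `σ` only through the ATOM `atomOf σ v` at the vertex `v = queryVertex ν q` the
  query is about: the σ-free twin `bitOracleL ν α` built from ANY atom assignment `α` agreeing with `atomOf σ` at
  that vertex answers `q` exactly as `bitOracle σ ν` does (`bitOracleL_eq_bitOracle`; the graph-theoretic core is
  `nbrSetLocal_atomOf : nbrSetLocal v (atomOf σ v) = (graph d σ).neighborFinset v`, i.e.
  `neighborFinset_of_depth_lt` for inner vertices and `neighborFinset_leafL` / `neighborFinset_leafR` for leaves);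
* (ii) the event `atomOf σ v = α` is a σ-free shape condition (`depth v = d ↔ α.isSome`) plus the two CYLINDER
  events `Cyl (atomPairs v α).1 σ.1`, `Cyl (atomPairs v α).2 σ.2` on the two permutations (`atomOf_eq_iff`).

[folklore] (objects: ChildsEtAl2003 §2 — the glued trees `G'_d(σ)` and their oracle; Patarin2009 §2 — cylinder
events of two-sided permutation transcripts.)
-/

set_option linter.dupNamespace false

noncomputable section

namespace Summit.QuantumAdvantage.QuantumAdvantage.Theorems.WbwObfuscatedGluedTrees.KnowledgeOfWalk.RealIdeal

open Literature.Computability.Complexity Literature.Computability.QuantumComplexity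
open Literature.Computability.QuantumComplexity.GluedTrees
open Literature.Computability.Cryptography Literature.Computability.Cryptography.ObfuscatedGluedTrees
open Summit.QuantumAdvantage.QuantumAdvantage.Theorems.WbwObfuscatedGluedTrees.KnowledgeOfWalk.BlackBox

variable {d N : ℕ}

/-! ## Cylinder events of explicit lists -/

/-- The empty cylinder event holds for every function. [folklore] -/
theorem cyl_nil {β : Type} (g : β → β) : Cyl [] g := fun _ h => nomatch h

/-- A one-constraint cylinder event: `Cyl [(x, y)] g ↔ g x = y`. [folklore] -/
theorem cyl_singleton {β : Type} (g : β → β) (x y : β) : Cyl [(x, y)] g ↔ g x = y := by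
  simp [Cyl]

/-- A two-constraint cylinder event: `Cyl [(x, y), (x', y')] g ↔ g x = y ∧ g x' = y'`. [folklore] -/
theorem cyl_pair {β : Type} (g : β → β) (x y x' y' : β) :
    Cyl [(x, y), (x', y')] g ↔ g x = y ∧ g x' = y' := by
  simp [Cyl]

/-! ## Atoms and constraint lists, vertex by vertex -/

/-- Inner vertices (depth `≠ d`) have atom `none`. [cite: ChildsEtAl2003, §2] -/
theorem atomOf_of_depth_ne (σ : CycleDatum d) {v : Vertex d} (hv : depth v ≠ d) : atomOf σ v = none := by
  unfold atomOf
  rw [dif_neg hv]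

/-- The leaf position of the left leaf `i` is `i`. [folklore] -/
theorem leafIdx_leafL (i : Fin (2 ^ d)) (h : depth (leafL d i) = d) : leafIdx (leafL d i) h = i := rfl

/-- The leaf position of the right leaf `i` is `i`. [folklore] -/
theorem leafIdx_leafR (i : Fin (2 ^ d)) (h : depth (leafR d i) = d) : leafIdx (leafR d i) h = i := rfl

/-- The atom of `σ = (e, f)` at the left leaf `i`: `(e⁻¹ i, crossR σ i)`. [cite: ChildsEtAl2003, §2] -/
theorem atomOf_leafL (σ : CycleDatum d) (i : Fin (2 ^ d)) :
    atomOf σ (leafL d i) = some (σ.1.symm i, crossR σ i) := by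
  unfold atomOf
  rw [dif_pos (depth_leafL i), leafIdx_leafL]
  rfl

/-- The atom of `σ = (e, f)` at the right leaf `i`: `(f⁻¹ i, crossL σ i)`. [cite: ChildsEtAl2003, §2] -/
theorem atomOf_leafR (σ : CycleDatum d) (i : Fin (2 ^ d)) :
    atomOf σ (leafR d i) = some (σ.2.symm i, crossL σ i) := by
  unfold atomOf
  rw [dif_pos (depth_leafR i), leafIdx_leafR]
  rfl

/-- Inner vertices (depth `≠ d`) impose no constraints, whatever the atom. [folklore] -/
theorem atomPairs_of_depth_ne {v : Vertex d} (hv : depth v ≠ d) (α : Atom d) : atomPairs v α = ([], []) := by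
  unfold atomPairs
  rcases α with _ | ⟨k, c₁, c₂⟩
  · rfl
  · exact dif_neg hv

/-- The constraint lists of the atom `(k, c₁, c₂)` at the left leaf `i`: `e k = i`; `f k = c₁`, `f (k - 1) = c₂`.
[cite: ChildsEtAl2003, §2] -/
theorem atomPairs_leafL (i k c₁ c₂ : Fin (2 ^ d)) :
    atomPairs (leafL d i) (some (k, c₁, c₂)) = ([(k, i)], [(k, c₁), ((finRotate (2 ^ d)).symm k, c₂)]) := by
  unfold atomPairs
  simp only
  rw [dif_pos (depth_leafL i), leafIdx_leafL]
  rfl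

/-- The constraint lists of the atom `(k, c₁, c₂)` at the right leaf `i`: `e k = c₁`, `e (k + 1) = c₂`; `f k = i`.
[cite: ChildsEtAl2003, §2] -/
theorem atomPairs_leafR (i k c₁ c₂ : Fin (2 ^ d)) :
    atomPairs (leafR d i) (some (k, c₁, c₂)) = ([(k, c₁), (finRotate (2 ^ d) k, c₂)], [(k, i)]) := by
  unfold atomPairs
  simp only
  rw [dif_pos (depth_leafR i), leafIdx_leafR]
  rfl

/-! ## (ii) Atoms are cylinder events -/

/-- **Atoms are cylinders**: `atomOf σ v = α` iff the σ-free shape condition `depth v = d ↔ α.isSome` holds and the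
two permutations satisfy the constraint lists `atomPairs v α` (for the left leaf `i` and `α = (k, c₁, c₂)`:
`e⁻¹ i = k ∧ crossR σ i = (c₁, c₂)` iff `e k = i ∧ f k = c₁ ∧ f (k - 1) = c₂`; symmetrically on the right).
[folklore] -/
theorem atomOf_eq_iff (σ : CycleDatum d) (v : Vertex d) (α : Atom d) :
    atomOf σ v = α ↔
      ((depth v = d ↔ α.isSome = true) ∧ Cyl (atomPairs v α).1 σ.1 ∧ Cyl (atomPairs v α).2 σ.2) := by
  by_cases h : depth v = d
  · obtain ⟨i, rfl | rfl⟩ := exists_eq_leaf h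
    · rw [atomOf_leafL]
      rcases α with _ | ⟨k, c₁, c₂⟩
      · simp
      · rw [atomPairs_leafL]
        simp only [Option.some.injEq, Prod.mk.injEq, crossR, depth_leafL, Option.isSome_some, true_and,
          cyl_singleton, cyl_pair]
        constructor
        · rintro ⟨rfl, rfl, rfl⟩
          exact ⟨σ.1.apply_symm_apply i, rfl, rfl⟩
        · rintro ⟨h1, rfl, rfl⟩
          obtain rfl : σ.1.symm i = k := by rw [Equiv.symm_apply_eq]; exact h1.symm
          exact ⟨rfl, rfl, rfl⟩
    · rw [atomOf_leafR]
      rcases α with _ | ⟨k, c₁, c₂⟩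
      · simp
      · rw [atomPairs_leafR]
        simp only [Option.some.injEq, Prod.mk.injEq, crossL, depth_leafR, Option.isSome_some, true_and,
          cyl_singleton, cyl_pair]
        constructor
        · rintro ⟨rfl, rfl, rfl⟩
          exact ⟨⟨rfl, rfl⟩, σ.2.apply_symm_apply i⟩
        · rintro ⟨⟨rfl, rfl⟩, h1⟩
          obtain rfl : σ.2.symm i = k := by rw [Equiv.symm_apply_eq]; exact h1.symm
          exact ⟨rfl, rfl, rfl⟩
  · rw [atomOf_of_depth_ne σ h, atomPairs_of_depth_ne h]
    rcases α with _ | ⟨k, c₁, c₂⟩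
    · simp [cyl_nil, h]
    · simp [h]

/-! ## (i) The bit oracle reads `σ` only through the atom at the queried vertex -/

/-- **The graph-theoretic core of locality** (`1 ≤ d`): the σ-free neighbour set at the atom of `σ` IS the
neighbourhood in `G'_d(σ)` — parent (if any) and children of an inner vertex (`neighborFinset_of_depth_lt`),
parent and the two cross leaves of a leaf (`neighborFinset_leafL` / `neighborFinset_leafR`).
[cite: ChildsEtAl2003, §2] -/
theorem nbrSetLocal_atomOf (hd : 1 ≤ d) (σ : CycleDatum d) (v : Vertex d) :
    nbrSetLocal v (atomOf σ v) = (graph d σ).neighborFinset v := by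
  by_cases h : depth v = d
  · rw [neighborFinset_of_depth_eq hd σ h]
    unfold nbrSetLocal atomOf cross₁ cross₂
    rw [if_neg (by omega), dif_pos h, dif_pos h, dif_pos h]
    cases v.1
    · simp only [if_false, Bool.false_eq_true]
    · simp only [if_true]
  · have hlt : depth v < d := lt_of_le_of_ne (depth_le v) h
    rw [neighborFinset_of_depth_lt σ hlt, atomOf_of_depth_ne σ h]
    unfold nbrSetLocal
    rw [if_pos hlt]

/-- A vertex whose name is the name part of a well-formed query is the vertex the query is about (`ν` is
injective). [folklore] -/
theorem eq_queryVertex (ν : NamingN d N) (q : List Bool) (h : q.length = N + N) {v : Vertex d}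
    (hv : ν v = fun i => q.get ((Fin.castAdd N i).cast h.symm)) : v = queryVertex ν q := by
  have hex : ∃ v, ν v = fun i => q.get ((Fin.castAdd N i).cast h.symm) := ⟨v, hv⟩
  unfold queryVertex
  rw [dif_pos h, dif_pos hex]
  exact ν.injective (hv.trans hex.choose_spec.symm)

/-- **Locality of the neighbour-name set**: if the atom assignment `α` agrees with `atomOf σ` at the queried vertex,
the σ-free neighbour names of the name part of a well-formed query are the true ones (the name filter is empty or
the singleton `{queryVertex ν q}`, on which `nbrSetLocal_atomOf` applies). [folklore] -/
theorem nbrNamesL_eq_nbrNames (hd : 1 ≤ d) (σ : CycleDatum d) (ν : NamingN d N) (α : Vertex d → Atom d)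
    (q : List Bool) (h : q.length = N + N) (hα : α (queryVertex ν q) = atomOf σ (queryVertex ν q)) :
    nbrNamesL ν α (fun i => q.get ((Fin.castAdd N i).cast h.symm)) =
      nbrNames σ ν (fun i => q.get ((Fin.castAdd N i).cast h.symm)) := by
  unfold nbrNamesL nbrNames
  refine Finset.biUnion_congr rfl fun v hv => ?_
  rw [Finset.mem_filter] at hv
  obtain rfl := eq_queryVertex ν q h hv.2
  rw [hα, nbrSetLocal_atomOf hd]

/-- **Locality of the bit oracle** (`1 ≤ d`): for every atom assignment `α` agreeing with `atomOf σ` at the vertex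
the query `q` is about, the σ-free bit oracle answers `q` as `bitOracle σ ν` does (ill-formed queries: both `[]`).
[folklore] -/
theorem bitOracleL_eq_bitOracle (hd : 1 ≤ d) (σ : CycleDatum d) (ν : NamingN d N) (α : Vertex d → Atom d)
    (q : List Bool) (hα : α (queryVertex ν q) = atomOf σ (queryVertex ν q)) :
    bitOracleL ν α q = bitOracle σ ν q := by
  unfold bitOracleL bitOracle
  by_cases h : q.length = N + N
  · rw [dif_pos h, dif_pos h]
    unfold nbrBitL nbrBit answerBitsL answerBits oracleL gluedTreesOracle
    rw [nbrNamesL_eq_nbrNames hd σ ν α q h hα]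
  · rw [dif_neg h, dif_neg h]

/-! ## The registered stub -/

/-- **Stub `stub_locality`** of crux stmt-QuantumAdvantage-2340, line `knowledge-of-walk-split` (stage 6): (i) the
bit oracle reads the cycle datum only through the atom at the queried vertex (`bitOracleL_eq_bitOracle`); (ii) the
event `atomOf σ v = α` is a σ-free shape condition plus the two cylinder events `atomPairs v α` on `σ.1`, `σ.2`
(`atomOf_eq_iff`). [folklore] -/
theorem stub_locality :
    (∀ (d N : ℕ), 1 ≤ d → ∀ (σ : CycleDatum d) (ν : NamingN d N) (α : Vertex d → Atom d) (q : List Bool),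
      α (queryVertex ν q) = atomOf σ (queryVertex ν q) → bitOracleL ν α q = bitOracle σ ν q) ∧
    (∀ (d : ℕ) (σ : CycleDatum d) (v : Vertex d) (α : Atom d),
      atomOf σ v = α ↔
        ((depth v = d ↔ α.isSome = true) ∧ Cyl (atomPairs v α).1 σ.1 ∧ Cyl (atomPairs v α).2 σ.2)) := by
  exact ⟨fun _ _ hd σ ν α q hα => bitOracleL_eq_bitOracle hd σ ν α q hα, fun _ σ v α => atomOf_eq_iff σ v α⟩

end Summit.QuantumAdvantage.QuantumAdvantage.Theorems.WbwObfuscatedGluedTrees.KnowledgeOfWalk.RealIdeal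

end
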